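import Summits.NavierStokesRegularity.NavierStokesRegularity.Theorems.LerayQuarterDissipationFiniteDissipationLiouvilleStability
import HarnessLib

/-!
# Crux `FiniteDissipationLiouville` (stmt-NavierStokesRegularity-22144): THE CRITICAL ELEMENT HAS
# THE SPACE-TIME TYPE-I ENVELOPE `‖W(t,x)‖ ≤ A/(‖x‖ + √(−t))`

Theorems file of route `LerayQuarterDissipation` (seat ns-lqd-p2 g7; `--supports` the crux).
Navier–Stokes regularity is NOT proved by anything here; no summit is.

`𝒟_{C,K}`: Type-I ancient mild fields (KNSS gauge, `‖w(t,x)‖ ≤ C/√(−t)`) with the law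
`∫ ‖∇w(s)‖² ≤ K/√(−s)`. A CRITICAL ELEMENT is a member of `𝒟_{C,K_c}` singular at the apex, with
`K_c` MINIMAL: no `𝒟_{C,K'}`, `K' < K_c`, has a singular member (ns-lqd-p1,
`CriticalElement.exists_minimal_singular`: if the crux fails for `C`, a critical element exists).
`CriticalPoint` (p609602): a critical element is regular at every final-time point `x₁ ≠ 0`.
`Stability` (this seat): regular points of a KNSS limit are uniformly regular for the tail of the
sequence. Together, by compactness ACROSS critical elements and scaling:

* `uniform_sphere_bound_of_minimal` — **uniformity**: there is `U = U(C,K_c)` with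
  `‖W(s,y)‖ ≤ U` for EVERY critical element `W`, every `s ∈ (−1, 0)` and every `‖y‖ = 1`
  (a violating sequence `W_k, s_k → 0⁻, y_k → y_∞` has a KNSS limit which is again a critical
  element — the class of critical elements is closed under these limits by persistence and the law
  of the limit — hence regular at `y_∞ ≠ 0`, and stability bounds the tail near `(0, y_∞)`);
* `envelope_of_minimal` — **THE ENVELOPE**: there is `A = A(C,K_c)` with
  `‖W(t,x)‖ ≤ A/(‖x‖ + √(−t))` for every critical element `W` and all `t < 0`, `x`
  (scaling: `W_{‖x‖}` is again a critical element; the sphere bound at `s = t/‖x‖²` inside the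
  parabola `‖x‖² > −t`, Type I outside): **every critical element lies in the Chae–Wolf / space-time
  Type-I envelope class `HasTypeIDecay A`**, the class of the tree's envelope bridge
  (`Hardness.exists_dissipationLaw_of_hasTypeIDecay`: envelope ⊂ `𝒟`) in which the literature on
  Type-I ancient solutions (Chae–Wolf 2017, Bradshaw–Tsai, Pineau–Vicol 2026) operates;
* `exists_criticalElement_hasTypeIDecay` — if some `𝒟_{C,K}` has a singular member, a critical
  element WITH the space-time envelope exists;
* `finiteDissipationLiouville_of_envelopeLiouville` — hence **the crux `FiniteDissipationLiouville`
  (body verbatim) follows from the Liouville statement for Type-I ancient mild fields WITH THE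
  SPACE-TIME ENVELOPE** (and the dissipation law): the residue of the crux lives entirely in the
  envelope class.

References: Koch–Nadirashvili–Seregin–Šverák, Acta Math. 203 (2009) = arXiv:0709.3599, §4;
Chae–Wolf, arXiv:1610.09464, Thm. 1.1 (the envelope for DSS profiles); Kenig–Merle 2006 (critical
elements); Albritton–Barker, arXiv:1811.00502, Prop. 2.3.
-/

noncomputable section

-- the summit and its single sub-problem share the name (CONVENTIONS §1), as in every Theorems file
set_option linter.dupNamespace false

namespace Summit.NavierStokesRegularity.NavierStokesRegularity.Theorems.FiniteDissipationLiouville.Envelope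

open MeasureTheory Set Filter Topology Metric Function
open Literature.Analysis Literature.Analysis.FluidPDE
open Summit.NavierStokesRegularity.NavierStokesRegularity.Theorems.FiniteDissipationLiouville
open Summit.NavierStokesRegularity.NavierStokesRegularity.Theorems.AdaptedFrequencyConverges.BirkhoffRecurrentHull
  (tendstoUniformlyOn_comp_of_tendsto)
open scoped ENNReal NNReal

/-- **Uniform bound for critical elements on the unit sphere up to the final time.** If `K_c` is
minimal for `C` (no `𝒟_{C,K'}`, `K' < K_c`, has a singular member), there is `U` such that every
member of `𝒟_{C,K_c}` which is singular at the apex satisfies `‖W(s,y)‖ ≤ U` for all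
`s ∈ (−1, 0)` and `‖y‖ = 1` (compactness across critical elements: `Compactness.seqLimit`,
`law_of_seqLimit`, `persistent_singularity_seq`; the limit is a critical element, regular at the
limit point `y_∞ ≠ 0` by `CriticalPoint.not_singular_translate_of_minimal`; the tail is uniformly
bounded there by `Stability.eventually_bounded_near_of_limit_bounded`; the violating times tend to
`0` by the Type I bound). [cite: KochNadirashviliSereginSverak2009, §4 (arXiv:0709.3599 p. 8)] -/
theorem uniform_sphere_bound_of_minimal {C Kc : ℝ}
    (hmin : ∀ K' : ℝ, K' < Kc → ∀ w : ℝ → EuclideanSpace ℝ (Fin 3) → EuclideanSpace ℝ (Fin 3),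
      IsTypeIAncientMild C w →
      (∀ s : ℝ, s < 0 → ∫⁻ x, ‖fderiv ℝ (w s) x‖ₑ ^ 2 ≤ ENNReal.ofReal (K' / Real.sqrt (-s))) →
      ¬ (∀ r > 0, ∀ M : ℝ, ∃ t ∈ Ioo (-(r ^ 2)) (0 : ℝ),
        ∃ x ∈ ball (0 : EuclideanSpace ℝ (Fin 3)) r, M < ‖w t x‖)) :
    ∃ U : ℝ, ∀ (W : ℝ → EuclideanSpace ℝ (Fin 3) → EuclideanSpace ℝ (Fin 3)),
      IsTypeIAncientMild C W →
      (∀ s : ℝ, s < 0 → ∫⁻ x, ‖fderiv ℝ (W s) x‖ₑ ^ 2 ≤ ENNReal.ofReal (Kc / Real.sqrt (-s))) →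
      (∀ r > 0, ∀ M : ℝ, ∃ t ∈ Ioo (-(r ^ 2)) (0 : ℝ),
        ∃ x ∈ ball (0 : EuclideanSpace ℝ (Fin 3)) r, M < ‖W t x‖) →
      ∀ s ∈ Ioo (-1 : ℝ) 0, ∀ y : EuclideanSpace ℝ (Fin 3), ‖y‖ = 1 → ‖W s y‖ ≤ U := by
  by_contra hcon
  push Not at hcon
  -- a violating sequence of critical elements
  choose W hW hlaw hsing s hs y hy hbig using fun k : ℕ => hcon (k : ℝ)
  have hC : 0 ≤ C := (hW 0).nonneg
  -- the violating times tend to `0⁻` (Type I: `k < ‖W_k(s_k,y_k)‖ ≤ C/√(−s_k)`)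
  have hsmall : ∀ k : ℕ, 0 < k → -(s k) < (C / k) ^ 2 := by
    intro k hk
    have hk' : (0 : ℝ) < k := by exact_mod_cast hk
    have h1 : (k : ℝ) < C / Real.sqrt (-(s k)) := (hbig k).trans_le ((hW k).norm_le (hs k).2 (y k))
    have hsq : 0 < Real.sqrt (-(s k)) := Real.sqrt_pos.2 (neg_pos.2 (hs k).2)
    rw [lt_div_iff₀ hsq] at h1
    have h2 : Real.sqrt (-(s k)) < C / k := by rw [lt_div_iff₀' hk']; linarith
    have h3 := pow_lt_pow_left₀ h2 hsq.le two_ne_zero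
    rwa [Real.sq_sqrt (neg_nonneg.2 (hs k).2.le)] at h3
  -- ## compactness across members: a critical limit
  obtain ⟨ψ, hψ, W', hW', hunif, -, hgrad⟩ := Compactness.seqLimit hW
  have hψt : Tendsto ψ atTop atTop := hψ.tendsto_atTop
  have hW'law : ∀ σ : ℝ, σ < 0 →
      ∫⁻ x, ‖fderiv ℝ (W' σ) x‖ₑ ^ 2 ≤ ENNReal.ofReal (Kc / Real.sqrt (-σ)) :=
    Compactness.law_of_seqLimit (Kinf := Kc) (Kk := fun _ => Kc) hψt hlaw
      (fun ε hε => Eventually.of_forall fun _ => by linarith) hgrad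
  have hW'sing := Compactness.persistent_singularity_seq (w := fun j => W (ψ j))
    (fun j => hW (ψ j)) (fun j => hlaw (ψ j)) (fun j => hsing (ψ j)) hW' hunif
  -- ## a convergent subsequence of the points on the unit sphere
  have hcpt : IsCompact (sphere (0 : EuclideanSpace ℝ (Fin 3)) 1) := isCompact_sphere 0 1
  obtain ⟨y₀, hy₀, φ, hφ, hyφ⟩ := hcpt.tendsto_subseq (x := fun j => y (ψ j))
    (fun j => mem_sphere_zero_iff_norm.2 (hy (ψ j)))
  have hy₀n : ‖y₀‖ = 1 := mem_sphere_zero_iff_norm.1 hy₀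
  have hy₀ne : y₀ ≠ 0 := by
    intro h; rw [h, norm_zero] at hy₀n; exact zero_ne_one hy₀n
  have hφt : Tendsto φ atTop atTop := hφ.tendsto_atTop
  -- ## the limit is regular at `y₀` (critical elements blow up at one point only)
  have hreg := CriticalPoint.not_singular_translate_of_minimal hW' hW'law hW'sing hmin hy₀ne
  push Not at hreg
  obtain ⟨r, hr, M, hM⟩ := hreg
  -- ## stability: the tail of the subsequence is uniformly bounded near `(0, y₀)`
  have hunif' : ∀ n : ℕ, TendstoUniformlyOn (fun j z => W (ψ (φ j)) z.1 z.2) (fun z => W' z.1 z.2)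
      atTop (Icc (-((n : ℝ) + 2)) (-(1 / ((n : ℝ) + 2))) ×ˢ
        closedBall (0 : EuclideanSpace ℝ (Fin 3)) ((n : ℝ) + 2)) :=
    fun n => tendstoUniformlyOn_comp_of_tendsto (hunif n) hφt
  obtain ⟨ρ, hρ, B, hB⟩ := Stability.eventually_bounded_near_of_limit_bounded
    (w := fun j => W (ψ (φ j))) (fun j => hW _) (fun j => hlaw _) hW' hunif' y₀ hr
    (fun t ht x hx => hM t ht x hx)
  -- ## the violating points enter the cylinder: contradiction
  have hidx : Tendsto (fun j => ψ (φ j)) atTop atTop := hψt.comp hφt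
  -- eventually `s_{ψ φ j} ∈ (−ρ², 0)`
  have hs_ev : ∀ᶠ j in atTop, s (ψ (φ j)) ∈ Ioo (-(ρ ^ 2)) (0 : ℝ) := by
    -- `C/k < ρ` for large `k`
    obtain ⟨N, hN⟩ := exists_nat_gt (C / ρ)
    filter_upwards [hidx.eventually_ge_atTop (max N 1)] with j hj
    set k : ℕ := ψ (φ j) with hk
    have hk1 : 1 ≤ k := le_of_max_le_right hj
    have hkN : N ≤ k := le_of_max_le_left hj
    have hkpos : (0 : ℝ) < k := by exact_mod_cast hk1
    have h1 := hsmall k hk1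
    have h2 : C / k < ρ := by
      rw [div_lt_iff₀ hkpos]
      have : (N : ℝ) ≤ k := by exact_mod_cast hkN
      rw [div_lt_iff₀ hρ] at hN
      nlinarith
    have h3 : (C / k) ^ 2 < ρ ^ 2 := pow_lt_pow_left₀ h2 (by positivity) two_ne_zero
    exact ⟨by linarith, (hs k).2⟩
  -- eventually `y_{ψ φ j} − y₀ ∈ B(0, ρ)`
  have hy_ev : ∀ᶠ j in atTop, y (ψ (φ j)) - y₀ ∈ ball (0 : EuclideanSpace ℝ (Fin 3)) ρ := by
    have h := (Metric.tendsto_nhds.1 hyφ) ρ hρ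
    filter_upwards [h] with j hj
    rwa [mem_ball_zero_iff, ← dist_eq_norm]
  -- eventually the index exceeds the bound `B`
  have hB_ev : ∀ᶠ j in atTop, B < (ψ (φ j) : ℝ) := by
    obtain ⟨N, hN⟩ := exists_nat_gt B
    filter_upwards [hidx.eventually_ge_atTop N] with j hj
    exact hN.trans_le (by exact_mod_cast hj)
  obtain ⟨j, hj⟩ := (((hB.and hs_ev).and hy_ev).and hB_ev).exists
  obtain ⟨⟨⟨hj1, hj2⟩, hj3⟩, hj4⟩ := hj
  have hbd := hj1 (s (ψ (φ j))) hj2 (y (ψ (φ j)) - y₀) hj3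
  rw [add_sub_cancel] at hbd
  have := hbig (ψ (φ j))
  linarith

/-- **THE SPACE-TIME TYPE-I ENVELOPE OF THE CRITICAL ELEMENT.** If `K_c` is minimal for `C`,
there is `A = A(C,K_c) ≥ 0` such that every member `W` of `𝒟_{C,K_c}` which is singular at the apex
satisfies `‖W(t,x)‖ ≤ A/(‖x‖ + √(−t))` for all `t < 0` and all `x` — i.e. `HasTypeIDecay A W`
(scaling `W ↦ W_{‖x‖}` preserves critical elements; the sphere bound inside the parabola
`‖x‖² > −t`, the Type I bound outside). [cite: KochNadirashviliSereginSverak2009, §4 (arXiv:0709.3599 p. 8)] [cite: ChaeWolf2017, Thm. 1.1 (arXiv:1610.09464 p. 3)] -/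
theorem envelope_of_minimal {C Kc : ℝ}
    (hmin : ∀ K' : ℝ, K' < Kc → ∀ w : ℝ → EuclideanSpace ℝ (Fin 3) → EuclideanSpace ℝ (Fin 3),
      IsTypeIAncientMild C w →
      (∀ s : ℝ, s < 0 → ∫⁻ x, ‖fderiv ℝ (w s) x‖ₑ ^ 2 ≤ ENNReal.ofReal (K' / Real.sqrt (-s))) →
      ¬ (∀ r > 0, ∀ M : ℝ, ∃ t ∈ Ioo (-(r ^ 2)) (0 : ℝ),
        ∃ x ∈ ball (0 : EuclideanSpace ℝ (Fin 3)) r, M < ‖w t x‖)) :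
    ∃ A : ℝ, 0 ≤ A ∧ ∀ (W : ℝ → EuclideanSpace ℝ (Fin 3) → EuclideanSpace ℝ (Fin 3)),
      IsTypeIAncientMild C W →
      (∀ s : ℝ, s < 0 → ∫⁻ x, ‖fderiv ℝ (W s) x‖ₑ ^ 2 ≤ ENNReal.ofReal (Kc / Real.sqrt (-s))) →
      (∀ r > 0, ∀ M : ℝ, ∃ t ∈ Ioo (-(r ^ 2)) (0 : ℝ),
        ∃ x ∈ ball (0 : EuclideanSpace ℝ (Fin 3)) r, M < ‖W t x‖) →
      HasTypeIDecay A W := by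
  obtain ⟨U, hU⟩ := uniform_sphere_bound_of_minimal hmin
  refine ⟨2 * (max U 0 + max C 0), by positivity, fun W hW hlaw hsing t ht x => ?_⟩
  have hC : 0 ≤ C := hW.nonneg
  have hCm : max C 0 = C := max_eq_left hC
  have hst : 0 < Real.sqrt (-t) := Real.sqrt_pos.2 (neg_pos.2 ht)
  have hden : 0 < ‖x‖ + Real.sqrt (-t) := by positivity
  rw [le_div_iff₀ hden, hCm]
  have hTI : ‖W t x‖ ≤ C / Real.sqrt (-t) := hW.norm_le ht x
  by_cases hpar : ‖x‖ ^ 2 ≤ -t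
  · -- outside the parabola: Type I
    have hxle : ‖x‖ ≤ Real.sqrt (-t) := by
      rw [← Real.sqrt_sq (norm_nonneg x)]; exact Real.sqrt_le_sqrt hpar
    have h1 : ‖W t x‖ * Real.sqrt (-t) ≤ C := by rwa [le_div_iff₀ hst] at hTI
    have h2 : ‖W t x‖ * ‖x‖ ≤ C :=
      (mul_le_mul_of_nonneg_left hxle (norm_nonneg _)).trans h1
    have hU0 : 0 ≤ max U 0 := le_max_right _ _
    nlinarith
  · -- inside the parabola: scale `‖x‖` to `1`
    push Not at hpar
    set lam : ℝ := ‖x‖ with hlam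
    have hlam0 : 0 < lam := by
      by_contra h
      push Not at h
      have h0 : lam = 0 := le_antisymm h (norm_nonneg x)
      rw [h0, sq, mul_zero] at hpar
      linarith [neg_pos.2 ht]
    set V : ℝ → EuclideanSpace ℝ (Fin 3) → EuclideanSpace ℝ (Fin 3) := nsRescale lam W with hV
    have hVc : IsTypeIAncientMild C V := isTypeIAncientMild_nsRescale hW hlam0
    have hVlaw := RecurrentReductionD.dissipationLaw_nsRescale hlaw hlam0
    have hVsing := RecurrentReductionD.singularAtOrigin_nsRescale hsing hlam0
    set σ : ℝ := t / lam ^ 2 with hσ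
    have hlam2 : 0 < lam ^ 2 := by positivity
    have hσI : σ ∈ Ioo (-1 : ℝ) 0 := by
      refine ⟨?_, div_neg_of_neg_of_pos ht hlam2⟩
      rw [hσ, lt_div_iff₀ hlam2]; linarith
    set y₁ : EuclideanSpace ℝ (Fin 3) := lam⁻¹ • x with hy₁
    have hy₁n : ‖y₁‖ = 1 := by
      rw [hy₁, norm_smul, norm_inv, Real.norm_of_nonneg hlam0.le, hlam, inv_mul_cancel₀ hlam0.ne']
    have hb := hU V hVc hVlaw hVsing σ hσI y₁ hy₁n
    have e : V σ y₁ = lam • W t x := by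
      rw [hV, nsRescale_apply, hσ, mul_div_cancel₀ _ hlam2.ne', hy₁, smul_smul,
        mul_inv_cancel₀ hlam0.ne', one_smul]
    rw [e, norm_smul, Real.norm_of_nonneg hlam0.le] at hb
    -- `lam ‖W t x‖ ≤ U`, `√(−t) < lam`
    have hsq : Real.sqrt (-t) < lam := by
      rw [← Real.sqrt_sq hlam0.le]
      exact Real.sqrt_lt_sqrt (neg_nonneg.2 ht.le) hpar
    have hUle : U ≤ max U 0 := le_max_left _ _
    have hn : 0 ≤ ‖W t x‖ := norm_nonneg _
    nlinarith

/-- **If the crux fails, a critical element WITH the space-time envelope exists**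
(`CriticalElement.exists_minimal_singular` + `envelope_of_minimal`). [cite: KochNadirashviliSereginSverak2009, §4 (arXiv:0709.3599 p. 8)] -/
theorem exists_criticalElement_hasTypeIDecay {C K : ℝ}
    {u : ℝ → EuclideanSpace ℝ (Fin 3) → EuclideanSpace ℝ (Fin 3)} (hu : IsTypeIAncientMild C u)
    (hlaw : ∀ s : ℝ, s < 0 → ∫⁻ x, ‖fderiv ℝ (u s) x‖ₑ ^ 2 ≤ ENNReal.ofReal (K / Real.sqrt (-s)))
    (hsing : ∀ r > 0, ∀ M : ℝ, ∃ t ∈ Ioo (-(r ^ 2)) (0 : ℝ),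
      ∃ x ∈ ball (0 : EuclideanSpace ℝ (Fin 3)) r, M < ‖u t x‖) :
    ∃ Kc A : ℝ, Kc ≤ K ∧ 0 ≤ A ∧ ∃ W : ℝ → EuclideanSpace ℝ (Fin 3) → EuclideanSpace ℝ (Fin 3),
      IsTypeIAncientMild C W ∧ HasTypeIDecay A W ∧
      (∀ s : ℝ, s < 0 → ∫⁻ x, ‖fderiv ℝ (W s) x‖ₑ ^ 2 ≤ ENNReal.ofReal (Kc / Real.sqrt (-s))) ∧
      (∀ r > 0, ∀ M : ℝ, ∃ t ∈ Ioo (-(r ^ 2)) (0 : ℝ),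
        ∃ x ∈ ball (0 : EuclideanSpace ℝ (Fin 3)) r, M < ‖W t x‖) ∧
      (∀ K' : ℝ, K' < Kc → ∀ w : ℝ → EuclideanSpace ℝ (Fin 3) → EuclideanSpace ℝ (Fin 3),
        IsTypeIAncientMild C w →
        (∀ s : ℝ, s < 0 → ∫⁻ x, ‖fderiv ℝ (w s) x‖ₑ ^ 2 ≤ ENNReal.ofReal (K' / Real.sqrt (-s))) →
        ¬ (∀ r > 0, ∀ M : ℝ, ∃ t ∈ Ioo (-(r ^ 2)) (0 : ℝ),
          ∃ x ∈ ball (0 : EuclideanSpace ℝ (Fin 3)) r, M < ‖w t x‖)) := by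
  obtain ⟨Kc, hKc, ⟨W, hW, hWlaw, hWsing⟩, hmin⟩ := CriticalElement.exists_minimal_singular hu hlaw hsing
  obtain ⟨A, hA, henv⟩ := envelope_of_minimal hmin
  exact ⟨Kc, A, hKc, hA, W, hW, henv W hW hWlaw hWsing, hWlaw, hWsing, hmin⟩

/-- **`FiniteDissipationLiouville` follows from the Liouville statement in the ENVELOPE class.**
If every Type-I ancient mild field (KNSS gauge) with the space-time envelope `HasTypeIDecay` and the
quarter-rate dissipation law is bounded on some backward cylinder at the origin, then so is every
member of every stratum `𝒟_{C,K}` — the body of the route decl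
`Theses.LerayQuarterDissipation.FiniteDissipationLiouville`, verbatim (a counterexample would yield
a critical element, which has the envelope). [cite: KochNadirashviliSereginSverak2009, §4 (arXiv:0709.3599 p. 8)] -/
theorem finiteDissipationLiouville_of_envelopeLiouville
    (h : ∀ (C A K : ℝ) (w : ℝ → EuclideanSpace ℝ (Fin 3) → EuclideanSpace ℝ (Fin 3)),
      IsTypeIAncientMild C w → HasTypeIDecay A w →
      (∀ s : ℝ, s < 0 → ∫⁻ x, ‖fderiv ℝ (w s) x‖ₑ ^ 2 ≤ ENNReal.ofReal (K / Real.sqrt (-s))) →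
      ¬ (∀ r > 0, ∀ M : ℝ, ∃ t ∈ Ioo (-(r ^ 2)) (0 : ℝ),
        ∃ x ∈ ball (0 : EuclideanSpace ℝ (Fin 3)) r, M < ‖w t x‖)) :
    ∀ (C K : ℝ) (ū : ℝ → EuclideanSpace ℝ (Fin 3) → EuclideanSpace ℝ (Fin 3)),
      IsTypeIAncientMild C ū →
      (∀ s : ℝ, s < 0 → ∫⁻ x, ‖fderiv ℝ (ū s) x‖ₑ ^ 2 ≤ ENNReal.ofReal (K / Real.sqrt (-s))) →
      ¬ (∀ r > 0, ∀ M : ℝ, ∃ t ∈ Set.Ioo (-(r ^ 2)) (0 : ℝ),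
        ∃ x ∈ Metric.ball (0 : EuclideanSpace ℝ (Fin 3)) r, M < ‖ū t x‖) := by
  intro C K u hu hlaw hsing
  obtain ⟨Kc, A, -, -, W, hW, henv, hWlaw, hWsing, -⟩ := exists_criticalElement_hasTypeIDecay hu hlaw hsing
  exact h C A Kc W hW henv hWlaw hWsing

end Summit.NavierStokesRegularity.NavierStokesRegularity.Theorems.FiniteDissipationLiouville.Envelope

end
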